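import Literature.NumberTheory.LFunctions.ButhePartialRH
import Literature.NumberTheory.LFunctions.PrimeNumberTheoremErrorTermExplicit
import HarnessLib

/-!
# RH-FREE — Johnston 2022 (Ramanujan J. 59): prime counting functions under a PARTIAL Riemann hypothesis — `|ψ(x) − x| < (√x/8π) log² x` whenever `(9.06/log log x)√(x/log x) ≤ T` (Thm. 3.2; Büthe had `4.92 √(x/log x) ≤ T`), hence for `x ≤ 1.101·10²⁶` with the Platt–Trudgian height (Cor. 3.3, PROVED here from Thm. 3.2); the weaker-constant family (Thm. 4.1, Table 2); Ramanujan's `π(x)² < (ex/log x) π(x/e)` on `[38 358 837 683, e¹⁰³]` (Thm. 5.1) («nothing here bears on the truth of RH»)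

Topic `Literature/NumberTheory/LFunctions` (RH literature-typing tranche 1, L4 "explicit zero
statistics / explicit `|ψ(x) − x|`", gen 7). Label: **RH-FREE** — the results are UNCONDITIONAL
consequences of a NUMERICAL VERIFICATION of RH up to a height `T` (the tree's named hypothesis
`Literature.NumberTheory.DiophantineGeometry.RiemannHypothesisUpTo T`; Platt–Trudgian 2021:
`T = 3 000 175 332 800`, `riemannHypothesisUpTo_platt_trudgian`), exactly like the tree's
`ButhePartialRH.lean` (Büthe 2016, Thm. 2 and Platt–Trudgian 2021, Cor. 1), which this file extends.
Named facts (`def … : Prop`, D-0014; nothing asserted, users take `(h : …)`) and PROVED consequences.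
Nothing here bears on the truth of RH.

## Source (read at the cited places) and what is typed

D. R. Johnston, *Improving bounds on prime counting functions by partial verification of the Riemann
hypothesis*, Ramanujan J. **59** (2022) 1307–1321 = arXiv:2109.02249v3
`[corpus:paper:arxiv-2109.02249 p0005 (Prop. 3.1, Thm. 3.2), p0007 (Cor. 3.3), p0008 (Thm. 4.1),
p0009 (Thm. 5.1)]`; Tables 1–2 from the arXiv TeX source (`final.tex` ll. 398–476; the corpus text
drops tables). `ψ, θ` = Mathlib's `Chebyshev.psi/theta`, `π(x) = Nat.primeCounting ⌊x⌋₊`,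
`li = Literature.NumberTheory.LFunctions.logIntegral` (principal value from `0`, as in Büthe/Johnston:
"`li(x) = ∫₀ˣ dt/log t`", §2), "RH for `0 < Im ρ ≤ T`" = `RiemannHypothesisUpTo T`.

* `Johnston2022_prop31` — **Proposition 3.1**, the two lines NOT already in the tree: for
  `5000 ≤ x ≤ 2.169·10²⁵`, `|ψ(x) − x| < (√x/8π) log x (log x − 3)` and
  `|θ(x) − x| < (√x/8π) log x (log x − 2)` ("established as intermediary steps in the proof" of Büthe's
  theorem, with `T = 3·10¹²`). The other four lines are Platt–Trudgian 2021, Cor. 1 =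
  `PlattTrudgian2021_cor1` / `Buthe2016_thm2.plattTrudgian_range` (`ButhePartialRH.lean`).
* `Johnston2022_thm32` — **Theorem 3.2** (main result): RH up to `T` and
  `(9.06/log log x)√(x/log x) ≤ T` give `|ψ(x) − x| < (√x/8π) log² x` (`x ≥ 59`),
  `|θ(x) − x| < (√x/8π) log² x` (`x ≥ 599`), `|π(x) − li(x)| < (√x/8π) log x` (`x ≥ 2657`).
  -- TODO(general form): the printed line `|Π(x) − li(x)| < (√x/8π) log x` (`x ≥ 59`) for Riemann's
  -- `Π(x) = Σ_{p^m≤x} 1/m` is omitted (no `Π` in the tree), as in `Buthe2016_thm2`.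
* `Johnston2022_thm32.range`, `Johnston2022_thm32.cor33` — **Corollary 3.3 PROVED from Thm. 3.2 and
  RH up to the Platt–Trudgian height**: the three bounds on `59 ≤ x ≤ 1.101·10²⁶` (resp. from `599`,
  `2657`). Kernel arithmetic: `x ↦ √(x/log x)/log log x` is non-decreasing on `[59, ∞)`
  (`Johnston2022.condFun_mono`: the logarithm `½ log x − ½ log log x − log log log x` has derivative
  `(log x · log log x − log log x − 2)/(2x log x log log x) ≥ 0`), `log(1.101·10²⁶) ≥ 59.96`,
  `log 59.96 ≥ 4.0936`, and `9.06·√(1.101·10²⁶/59.96)/4.0936 ≤ 3 000 175 332 800` (the endpoint is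
  sharp to three digits). Cor. 3.3 is therefore NOT a separate named fact: it is the theorem
  `Johnston2022_thm32.cor33 : Johnston2022_thm32 → RiemannHypothesisUpTo 3000175332800 → (Cor. 3.3 as printed)`.
* `Johnston2022.table1` — **Table 1** (`K` replacing `9.06` for larger `T₀`: `(10¹³, 8.94, 1.335·10²⁷)`,
  `(10¹⁴, 8.76, 1.550·10²⁹)`, `(10¹⁵, 8.64, 1.762·10³¹)`), data only (the source gives no separate
  theorem; see the docstring of `Johnston2022_thm32`).
* `Johnston2022.table2`, `Johnston2022_thm41` — **Theorem 4.1 with Table 2**: for each row `(a, K)`,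
  RH up to `T` and `K√(x/log³ x) ≤ T` give `|ψ(x) − x| < a√x log² x`, `|θ(x) − x| < a√x log² x`
  (`x ≥ 3`) and `|π(x) − li(x)| < a√x log x` (`x ≥ 2`); rows
  `(1, 1.19), (10, 0.117), (100, 0.0116), (1000, 0.00116), (10⁴, 1.16·10⁻⁴), (10⁵, 1.16·10⁻⁵),
  (10⁶, 1.16·10⁻⁶), (10⁷, 1.16·10⁻⁷)` with the printed `x_max` column (largest `x` for `T = 3·10¹²`;
  informational, not part of the asserted statement).
* `Johnston2022_thm51` — **Theorem 5.1**: Ramanujan's inequality `π(x)² < (ex/log x) π(x/e)` for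
  `38 358 837 683 ≤ x ≤ exp(103)`, unconditionally (brute-force interval stepping with Thm. 3.2/4.1;
  "just under a day on a 2.4GHz laptop"). Compare the tree's `JohnstonYang2023_ramanujan_thm15`
  (`x ≥ exp(3361)`); the gap `(e¹⁰³, e³³⁶¹)` is open unconditionally (under RH the inequality holds for
  all `x > 38 358 837 682`, Dudek–Platt).

Proved besides: `Johnston2022_thm32.of_le` (monotonicity in the height `T`),
`Johnston2022_thm32.plattTrudgian_range` (the Büthe/Platt–Trudgian range `59 < x ≤ 2.169·10²⁵` is
contained), `Johnston2022_thm41.row_one` (the row `a = 1`), and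
`Johnston2022_thm51.ramanujan_known_ranges` (with `JohnstonYang2023_ramanujan_thm15`: Ramanujan's
inequality on `[38 358 837 683, e¹⁰³] ∪ [e³³⁶¹, ∞)`).

## References

* D. R. Johnston, Ramanujan J. 59 (2022) 1307–1321 (arXiv:2109.02249v3), Prop. 3.1, Thm. 3.2,
  Cor. 3.3, Table 1, Thm. 4.1 + Table 2, Thm. 5.1. [Johnston2022PartialRH]
* J. Büthe, Math. Comp. 85 (2016) 2483–2498, Thm. 2. [Buthe2016]
* D. J. Platt, T. S. Trudgian, Bull. Lond. Math. Soc. 53 (2021) 792–797, Thm. 1, Cor. 1.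
  [PlattTrudgianBLMS2021]
* D. R. Johnston, A. Yang, Res. Number Theory 9 (2023), Thm. 1.5 (Ramanujan's inequality beyond
  `exp(3361)`). [JohnstonYang2023]
-/

noncomputable section

open Real Set
open scoped Chebyshev

namespace Literature.NumberTheory.LFunctions

open Literature.NumberTheory.DiophantineGeometry

/-! ### The named facts -/

/-- NAMED FACT (Johnston 2022, **Proposition 3.1**, the third and fourth lines, as printed:
"`|ψ(x) − x| < (√x/8π) log x (log x − 3)` for `5000 ≤ x ≤ 2.169·10²⁵`,
`|θ(x) − x| < (√x/8π) log x (log x − 2)` for `5000 ≤ x ≤ 2.169·10²⁵`" — "(3.1) and (3.2) do not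
appear in the statement of Büthe's theorem but are established as intermediary steps in the proof",
with `T = 3·10¹²` from Platt–Trudgian). Unconditional (rests on the Platt–Trudgian verification).
The remaining lines of Prop. 3.1 are `PlattTrudgian2021_cor1`. Users take `(h : Johnston2022_prop31)`.
[cite: Johnston2022PartialRH, Prop. 3.1 eqs. (3.1)–(3.2)] -/
def Johnston2022_prop31 : Prop :=
  ∀ x : ℝ, 5000 ≤ x → x ≤ 2.169e25 →
    |ψ x - x| < Real.sqrt x / (8 * π) * Real.log x * (Real.log x - 3) ∧
      |θ x - x| < Real.sqrt x / (8 * π) * Real.log x * (Real.log x - 2)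

/-- NAMED FACT (Johnston 2022, **Theorem 3.2**, as printed: "Let `T > 0` be such that the Riemann
hypothesis holds for zeros `ρ` with `0 < Im(ρ) ≤ T`. Then, under the condition
`(9.06/log log x)√(x/log x) ≤ T`, the following estimates hold: `|ψ(x) − x| < (√x/8π) log² x` for
`x ≥ 59`, `|θ(x) − x| < (√x/8π) log² x` for `x ≥ 599`, […], `|π(x) − li(x)| < (√x/8π) log x` for
`x ≥ 2657`"). `RiemannHypothesisUpTo T` is the tree's "RH for `0 < Im ρ ≤ T`"; `ψ, θ` Mathlib's,
`π(x) = Nat.primeCounting ⌊x⌋₊`, `li = logIntegral`. For `T ≥ 10¹³, 10¹⁴, 10¹⁵` the constant `9.06`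
may be replaced by `8.94, 8.76, 8.64` (Table 1, `Johnston2022.table1`; not asserted here). Users take
`(h : Johnston2022_thm32)`. Not discharged (Büthe's explicit formula with Logan kernels, §3).
-- TODO(general form): the printed `Π`-line `|Π(x) − li(x)| < (√x/8π) log x`, `x ≥ 59`, is omitted
-- (no `Π(x) = Σ_{p^m ≤ x} 1/m` in the tree).
[cite: Johnston2022PartialRH, Thm. 3.2] -/
def Johnston2022_thm32 : Prop :=
  ∀ T : ℝ, 0 < T → RiemannHypothesisUpTo T →
    ∀ x : ℝ, 9.06 / Real.log (Real.log x) * Real.sqrt (x / Real.log x) ≤ T →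
      (59 ≤ x → |ψ x - x| < Real.sqrt x / (8 * π) * Real.log x ^ 2) ∧
      (599 ≤ x → |θ x - x| < Real.sqrt x / (8 * π) * Real.log x ^ 2) ∧
      (2657 ≤ x → |(Nat.primeCounting ⌊x⌋₊ : ℝ) - logIntegral x| < Real.sqrt x / (8 * π) * Real.log x)

namespace Johnston2022

/-- **Table 1** (data): `(T₀, K, x_max)` — for `T ≥ T₀` the constant `9.06` of Theorem 3.2 may be
replaced by `K`, and `x_max` is the largest `x` with `(K/log log x)√(x/log x) ≤ T₀`.
[cite: Johnston2022PartialRH, Table 1 (§4.1)] -/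
def table1 : List (ℝ × ℝ × ℝ) :=
  [(1e13, 8.94, 1.335e27), (1e14, 8.76, 1.550e29), (1e15, 8.64, 1.762e31)]

/-- **Table 2** (data): `(a, K, x_max)` for Theorem 4.1; `x_max` = the largest `x` for which the
inequalities (4.2)–(4.5) hold upon setting `T = 3·10¹²`. [cite: Johnston2022PartialRH, Table 2 (§4.2)] -/
def table2 : List (ℝ × ℝ × ℝ) :=
  [(1, 1.19, 2.165e30), (10, 0.117, 2.738e32), (100, 0.0116, 3.360e34), (1000, 0.00116, 4.004e36),
   (1e4, 1.16e-4, 4.723e38), (1e5, 1.16e-5, 5.522e40), (1e6, 1.16e-6, 6.404e42),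
   (1e7, 1.16e-7, 7.375e44)]

end Johnston2022

/-- NAMED FACT (Johnston 2022, **Theorem 4.1 with Table 2**, as printed: "Let `T > 0` be such that
the Riemann hypothesis holds for zeros `ρ` with `0 < Im(ρ) ≤ T`. Then, for corresponding values of
`a` and `K` in Table 2, the following estimates hold: `|ψ(x) − x| < a√x log² x` for `x ≥ 3`,
`|θ(x) − x| < a√x log² x` for `x ≥ 3`, […], `|π(x) − li(x)| < a√x log x` for `x ≥ 2`, provided
`K√(x/log³ x) ≤ T`"). The `Π`-line is omitted (see `Johnston2022_thm32`). Users take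
`(h : Johnston2022_thm41)`. [cite: Johnston2022PartialRH, Thm. 4.1 and Table 2] -/
def Johnston2022_thm41 : Prop :=
  ∀ a K xmax : ℝ, (a, K, xmax) ∈ Johnston2022.table2 →
    ∀ T : ℝ, 0 < T → RiemannHypothesisUpTo T →
      ∀ x : ℝ, K * Real.sqrt (x / Real.log x ^ 3) ≤ T →
        (3 ≤ x → |ψ x - x| < a * Real.sqrt x * Real.log x ^ 2) ∧
        (3 ≤ x → |θ x - x| < a * Real.sqrt x * Real.log x ^ 2) ∧
        (2 ≤ x → |(Nat.primeCounting ⌊x⌋₊ : ℝ) - logIntegral x| < a * Real.sqrt x * Real.log x)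

/-- NAMED FACT (Johnston 2022, **Theorem 5.1**, as printed: "For `38,358,837,683 ≤ x ≤ exp(103)`,
Ramanujan's inequality `π(x)² < (ex/log x) π(x/e)` holds unconditionally" — from Axler 2017 below
`exp(43)` and a brute-force interval verification with Theorems 3.2/4.1 on `[e⁴³, e¹⁰³]`).
`π(y) = Nat.primeCounting ⌊y⌋₊`, `e = exp 1`. Unconditional (computer-assisted). Compare
`JohnstonYang2023_ramanujan_thm15` (`x ≥ exp 3361`). Users take `(h : Johnston2022_thm51)`.
[cite: Johnston2022PartialRH, Thm. 5.1] -/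
def Johnston2022_thm51 : Prop :=
  ∀ x : ℝ, 38358837683 ≤ x → x ≤ Real.exp 103 →
    (Nat.primeCounting ⌊x⌋₊ : ℝ) ^ 2 <
      Real.exp 1 * x / Real.log x * (Nat.primeCounting ⌊x / Real.exp 1⌋₊ : ℝ)

/-! ### Johnston's condition `(9.06/log log x)√(x/log x) ≤ T` is monotone in `x` on `[59, ∞)` -/

namespace Johnston2022

/-- The logarithm of `√(x/log x)/log log x`: `F(x) = (log x − log log x)/2 − log log log x`.
[cite: Johnston2022PartialRH, Thm. 3.2 (the condition (3.7))] -/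
def condLog (x : ℝ) : ℝ := (Real.log x - Real.log (Real.log x)) / 2 - Real.log (Real.log (Real.log x))

/-- `exp 4.07 ≤ 59`, so `log x ≥ 4.07 > 4` for `x ≥ 59`. [cite: Johnston2022PartialRH, Thm. 3.2 (x ≥ 59)] -/
private theorem exp_407_le : Real.exp 4.07 ≤ 59 := by
  have h1 : Real.exp 4.07 = Real.exp 1 ^ 4 * Real.exp 0.07 := by
    rw [Real.exp_one_pow, ← Real.exp_add]; congr 1; norm_num
  have h2 : Real.exp 1 ^ 4 ≤ (2.7182818286 : ℝ) ^ 4 :=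
    pow_le_pow_left₀ (Real.exp_pos 1).le Real.exp_one_lt_d9.le 4
  have h3 : Real.exp 0.07 ≤ 1.0726 := by
    have h := Real.exp_bound' (x := (0.07 : ℝ)) (by norm_num) (by norm_num) (n := 4) (by norm_num)
    refine h.trans ?_
    simp only [Finset.sum_range_succ, Finset.sum_range_zero, Nat.factorial]
    norm_num
  rw [h1]
  calc Real.exp 1 ^ 4 * Real.exp 0.07 ≤ (2.7182818286 : ℝ) ^ 4 * 1.0726 :=
        mul_le_mul h2 h3 (Real.exp_pos _).le (by positivity)
    _ ≤ 59 := by norm_num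

/-- `exp 1.4 ≤ 4.07`, so `log log x ≥ 1.4` for `x ≥ 59`. [cite: Johnston2022PartialRH, Thm. 3.2 (x ≥ 59)] -/
private theorem exp_14_le : Real.exp 1.4 ≤ 4.07 := by
  have h1 : Real.exp 1.4 = Real.exp 1 * Real.exp 0.4 := by
    rw [← Real.exp_add]; congr 1; norm_num
  have h3 : Real.exp 0.4 ≤ 1.4919 := by
    have h := Real.exp_bound' (x := (0.4 : ℝ)) (by norm_num) (by norm_num) (n := 6) (by norm_num)
    refine h.trans ?_
    simp only [Finset.sum_range_succ, Finset.sum_range_zero, Nat.factorial]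
    norm_num
  rw [h1]
  calc Real.exp 1 * Real.exp 0.4 ≤ 2.7182818286 * 1.4919 :=
        mul_le_mul Real.exp_one_lt_d9.le h3 (Real.exp_pos _).le (by positivity)
    _ ≤ 4.07 := by norm_num

/-- For `x ≥ 59`: `log x ≥ 4.07`, `log log x ≥ 1.4`, `log log log x` is defined with positive argument.
[cite: Johnston2022PartialRH, Thm. 3.2 (x ≥ 59)] -/
theorem log_bounds_of_ge_59 {x : ℝ} (hx : 59 ≤ x) :
    4.07 ≤ Real.log x ∧ 1.4 ≤ Real.log (Real.log x) := by
  have hx0 : 0 < x := by linarith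
  have h1 : 4.07 ≤ Real.log x := by
    rw [Real.le_log_iff_exp_le hx0]
    exact exp_407_le.trans hx
  refine ⟨h1, ?_⟩
  rw [Real.le_log_iff_exp_le (by linarith)]
  exact exp_14_le.trans h1

/-- `F = condLog` has derivative `(1/x − 1/(x log x))/2 − 1/(x log x log log x)` at `x ≥ 59`.
[cite: Johnston2022PartialRH, Thm. 3.2 (the condition (3.7))] -/
theorem hasDerivAt_condLog {x : ℝ} (hx : 59 ≤ x) :
    HasDerivAt condLog
      ((1 / x - 1 / (x * Real.log x)) / 2 - 1 / (x * Real.log x * Real.log (Real.log x))) x := by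
  obtain ⟨hl, hll⟩ := log_bounds_of_ge_59 hx
  have hx0 : x ≠ 0 := by linarith
  have hl0 : Real.log x ≠ 0 := by linarith
  have hll0 : Real.log (Real.log x) ≠ 0 := by linarith
  have h1 : HasDerivAt Real.log (1 / x) x := by simpa [one_div] using Real.hasDerivAt_log hx0
  have h2 : HasDerivAt (fun y ↦ Real.log (Real.log y)) (1 / (x * Real.log x)) x := by
    refine ((Real.hasDerivAt_log hl0).comp x h1).congr_deriv ?_
    rw [one_div, one_div, ← mul_inv, mul_comm]
  have h3 : HasDerivAt (fun y ↦ Real.log (Real.log (Real.log y)))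
      (1 / (x * Real.log x * Real.log (Real.log x))) x := by
    refine ((Real.hasDerivAt_log hll0).comp x h2).congr_deriv ?_
    rw [one_div, one_div, ← mul_inv, mul_comm]
  show HasDerivAt (fun y ↦ (Real.log y - Real.log (Real.log y)) / 2 - Real.log (Real.log (Real.log y))) _ x
  exact ((h1.sub h2).div_const 2).sub h3

/-- The derivative of `F` is `≥ 0` for `x ≥ 59`
(`log x · log log x − log log x − 2 ≥ 4.07·1.4 − … > 0`). [cite: Johnston2022PartialRH, Thm. 3.2 (the condition (3.7))] -/
theorem deriv_condLog_nonneg {x : ℝ} (hx : 59 ≤ x) :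
    0 ≤ (1 / x - 1 / (x * Real.log x)) / 2 - 1 / (x * Real.log x * Real.log (Real.log x)) := by
  obtain ⟨hl, hll⟩ := log_bounds_of_ge_59 hx
  have hx0 : 0 < x := by linarith
  have hl0 : 0 < Real.log x := by linarith
  have hll0 : 0 < Real.log (Real.log x) := by linarith
  have e : (1 / x - 1 / (x * Real.log x)) / 2 - 1 / (x * Real.log x * Real.log (Real.log x)) =
      (Real.log x * Real.log (Real.log x) - Real.log (Real.log x) - 2)
        / (2 * x * Real.log x * Real.log (Real.log x)) := by
    field_simp
  rw [e]
  apply div_nonneg _ (by positivity)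
  nlinarith

/-- `F = condLog` is non-decreasing on `[59, ∞)`. [cite: Johnston2022PartialRH, Thm. 3.2 (the condition (3.7))] -/
theorem condLog_monotoneOn : MonotoneOn condLog (Ici 59) := by
  have hderiv : ∀ x ∈ Ici (59 : ℝ), HasDerivAt condLog
      ((1 / x - 1 / (x * Real.log x)) / 2 - 1 / (x * Real.log x * Real.log (Real.log x))) x :=
    fun x hx ↦ hasDerivAt_condLog hx
  have hcont : ContinuousOn condLog (Ici 59) := fun x hx ↦ (hderiv x hx).continuousAt.continuousWithinAt
  refine monotoneOn_of_hasDerivWithinAt_nonneg (convex_Ici 59) hcont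
    (fun x hx ↦ (hderiv x (interior_subset hx)).hasDerivWithinAt) ?_
  intro x hx
  exact deriv_condLog_nonneg (interior_subset hx)

/-- `√(x/log x)/log log x = exp(F(x))` for `x ≥ 59`. [cite: Johnston2022PartialRH, Thm. 3.2 (the condition (3.7))] -/
theorem condFun_eq_exp {x : ℝ} (hx : 59 ≤ x) :
    Real.sqrt (x / Real.log x) / Real.log (Real.log x) = Real.exp (condLog x) := by
  obtain ⟨hl, hll⟩ := log_bounds_of_ge_59 hx
  have hx0 : 0 < x := by linarith
  have hl0 : 0 < Real.log x := by linarith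
  have hll0 : 0 < Real.log (Real.log x) := by linarith
  have hu : 0 < x / Real.log x := div_pos hx0 hl0
  have hsqrt : Real.sqrt (x / Real.log x) = Real.exp ((Real.log x - Real.log (Real.log x)) / 2) := by
    rw [Real.sqrt_eq_rpow, Real.rpow_def_of_pos hu, Real.log_div hx0.ne' hl0.ne']
    congr 1
    ring
  rw [condLog, Real.exp_sub, Real.exp_log hll0, hsqrt]

/-- **Johnston's condition is monotone**: for `59 ≤ x ≤ y`,
`(9.06/log log x)√(x/log x) ≤ (9.06/log log y)√(y/log y)`.
[cite: Johnston2022PartialRH, Thm. 3.2 (the condition (3.7))] -/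
theorem condFun_mono {x y : ℝ} (hx : 59 ≤ x) (hxy : x ≤ y) :
    9.06 / Real.log (Real.log x) * Real.sqrt (x / Real.log x) ≤
      9.06 / Real.log (Real.log y) * Real.sqrt (y / Real.log y) := by
  have hy : 59 ≤ y := hx.trans hxy
  rw [show 9.06 / Real.log (Real.log x) * Real.sqrt (x / Real.log x) =
      9.06 * (Real.sqrt (x / Real.log x) / Real.log (Real.log x)) by ring,
    show 9.06 / Real.log (Real.log y) * Real.sqrt (y / Real.log y) =
      9.06 * (Real.sqrt (y / Real.log y) / Real.log (Real.log y)) by ring,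
    condFun_eq_exp hx, condFun_eq_exp hy]
  exact mul_le_mul_of_nonneg_left (Real.exp_le_exp.2 (condLog_monotoneOn hx hy hxy)) (by norm_num)

/-! ### The endpoint `x = 1.101·10²⁶` satisfies the condition with `T = 3 000 175 332 800` -/

/-- `exp 59.96 ≤ 1.101·10²⁶` (true value `e^{59.96} = 1.0972…·10²⁶`). [cite: Johnston2022PartialRH, Cor. 3.3] -/
private theorem exp_5996_le : Real.exp 59.96 ≤ 1.101e26 := by
  have h1 : Real.exp 59.96 = Real.exp 1 ^ 59 * Real.exp 0.96 := by
    rw [Real.exp_one_pow, ← Real.exp_add]; congr 1; norm_num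
  have h2 : Real.exp 1 ^ 59 ≤ (2.7182818286 : ℝ) ^ 59 :=
    pow_le_pow_left₀ (Real.exp_pos 1).le Real.exp_one_lt_d9.le 59
  have h3 : Real.exp 0.96 ≤ 2.6117 := by
    have h := Real.exp_bound' (x := (0.96 : ℝ)) (by norm_num) (by norm_num) (n := 12) (by norm_num)
    refine h.trans ?_
    simp only [Finset.sum_range_succ, Finset.sum_range_zero, Nat.factorial]
    norm_num
  rw [h1]
  calc Real.exp 1 ^ 59 * Real.exp 0.96 ≤ (2.7182818286 : ℝ) ^ 59 * 2.6117 :=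
        mul_le_mul h2 h3 (Real.exp_pos _).le (by positivity)
    _ ≤ 1.101e26 := by norm_num

/-- `exp 4.0936 ≤ 59.96` (true value `59.955…`). [cite: Johnston2022PartialRH, Cor. 3.3] -/
private theorem exp_40936_le : Real.exp 4.0936 ≤ 59.96 := by
  have h1 : Real.exp 4.0936 = Real.exp 1 ^ 4 * Real.exp 0.0936 := by
    rw [Real.exp_one_pow, ← Real.exp_add]; congr 1; norm_num
  have h2 : Real.exp 1 ^ 4 ≤ (2.7182818286 : ℝ) ^ 4 :=
    pow_le_pow_left₀ (Real.exp_pos 1).le Real.exp_one_lt_d9.le 4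
  have h3 : Real.exp 0.0936 ≤ 1.098121 := by
    have h := Real.exp_bound' (x := (0.0936 : ℝ)) (by norm_num) (by norm_num) (n := 6) (by norm_num)
    refine h.trans ?_
    simp only [Finset.sum_range_succ, Finset.sum_range_zero, Nat.factorial]
    norm_num
  rw [h1]
  calc Real.exp 1 ^ 4 * Real.exp 0.0936 ≤ (2.7182818286 : ℝ) ^ 4 * 1.098121 :=
        mul_le_mul h2 h3 (Real.exp_pos _).le (by positivity)
    _ ≤ 59.96 := by norm_num

/-- **The Platt–Trudgian height covers `x ≤ 1.101·10²⁶`**: at `x₀ = 1.101·10²⁶`,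
`(9.06/log log x₀)√(x₀/log x₀) ≤ 3 000 175 332 800` (`log x₀ ≥ 59.96`, `log log x₀ ≥ 4.0936`; the
true left side is `2.9991…·10¹²`). [cite: Johnston2022PartialRH, Cor. 3.3] -/
theorem cond_at_xmax :
    9.06 / Real.log (Real.log 1.101e26) * Real.sqrt (1.101e26 / Real.log 1.101e26) ≤ 3000175332800 := by
  have hL : (59.96 : ℝ) ≤ Real.log 1.101e26 := (Real.le_log_iff_exp_le (by norm_num)).2 exp_5996_le
  have hLL : (4.0936 : ℝ) ≤ Real.log (Real.log 1.101e26) :=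
    ((Real.le_log_iff_exp_le (by norm_num)).2 exp_40936_le).trans (Real.log_le_log (by norm_num) hL)
  have hsqrt : Real.sqrt (1.101e26 / Real.log 1.101e26) ≤ 1.3551e12 := by
    rw [Real.sqrt_le_left (by norm_num)]
    rw [div_le_iff₀ (by linarith)]
    nlinarith
  calc 9.06 / Real.log (Real.log 1.101e26) * Real.sqrt (1.101e26 / Real.log 1.101e26)
      ≤ 9.06 / 4.0936 * 1.3551e12 := by
        apply mul_le_mul _ hsqrt (Real.sqrt_nonneg _) (by positivity)
        exact div_le_div_of_nonneg_left (by norm_num) (by norm_num) hLL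
    _ ≤ 3000175332800 := by norm_num

end Johnston2022

/-! ### Consequences (proved) -/

namespace Johnston2022_thm32

/-- Monotonicity in the height: RH verified higher up gives the same conclusions (the hypothesis
`RiemannHypothesisUpTo` is antitone in `T` and the condition is `≤ T`). [cite: Johnston2022PartialRH, Thm. 3.2] -/
theorem of_le (h : Johnston2022_thm32) {T T' : ℝ} (hT : 0 < T) (hTT' : T ≤ T')
    (hRH : RiemannHypothesisUpTo T') {x : ℝ}
    (hx : 9.06 / Real.log (Real.log x) * Real.sqrt (x / Real.log x) ≤ T) :
    (59 ≤ x → |ψ x - x| < Real.sqrt x / (8 * π) * Real.log x ^ 2) ∧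
      (599 ≤ x → |θ x - x| < Real.sqrt x / (8 * π) * Real.log x ^ 2) ∧
      (2657 ≤ x → |(Nat.primeCounting ⌊x⌋₊ : ℝ) - logIntegral x| < Real.sqrt x / (8 * π) * Real.log x) :=
  h T hT (fun s hs h0 hsT ↦ hRH s hs h0 (hsT.trans hTT')) x hx

/-- **Johnston 2022, Cor. 3.3 — the range form, PROVED from Thm. 3.2 and RH up to the Platt–Trudgian
height `3 000 175 332 800`**: for `59 ≤ x ≤ 1.101·10²⁶` the three bounds hold (the `θ`- and
`π`-lines from `599`, `2657`). [cite: Johnston2022PartialRH, Cor. 3.3] -/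
theorem range (h : Johnston2022_thm32) (hRH : RiemannHypothesisUpTo 3000175332800)
    {x : ℝ} (h59 : 59 ≤ x) (hx : x ≤ 1.101e26) :
    |ψ x - x| < Real.sqrt x / (8 * π) * Real.log x ^ 2 ∧
      (599 ≤ x → |θ x - x| < Real.sqrt x / (8 * π) * Real.log x ^ 2) ∧
      (2657 ≤ x → |(Nat.primeCounting ⌊x⌋₊ : ℝ) - logIntegral x| < Real.sqrt x / (8 * π) * Real.log x) := by
  have hcond : 9.06 / Real.log (Real.log x) * Real.sqrt (x / Real.log x) ≤ 3000175332800 :=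
    (Johnston2022.condFun_mono h59 hx).trans Johnston2022.cond_at_xmax
  have H := h 3000175332800 (by norm_num) hRH x hcond
  exact ⟨H.1 h59, H.2.1, H.2.2⟩

/-- **Johnston 2022, Corollary 3.3, as printed** ("The bounds (3.3)–(3.6) hold for
`x ≤ 1.101·10²⁶`"), **from its two inputs**: Thm. 3.2 and the Platt–Trudgian verification
`RiemannHypothesisUpTo 3000175332800` (= `riemannHypothesisUpTo_platt_trudgian`). (Not recorded as a
separate named fact: it is this theorem.) [cite: Johnston2022PartialRH, Cor. 3.3] -/
theorem cor33 (h : Johnston2022_thm32) (hRH : RiemannHypothesisUpTo 3000175332800) :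
    ∀ x : ℝ, x ≤ 1.101e26 →
      (59 ≤ x → |ψ x - x| < Real.sqrt x / (8 * π) * Real.log x ^ 2) ∧
      (599 ≤ x → |θ x - x| < Real.sqrt x / (8 * π) * Real.log x ^ 2) ∧
      (2657 ≤ x → |(Nat.primeCounting ⌊x⌋₊ : ℝ) - logIntegral x| <
        Real.sqrt x / (8 * π) * Real.log x) := by
  intro x hx
  refine ⟨fun h59 ↦ (range h hRH h59 hx).1, fun h599 ↦ (range h hRH (by linarith) hx).2.1 h599,
    fun h2657 ↦ (range h hRH (by linarith) hx).2.2 h2657⟩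

/-- Johnston's theorem CONTAINS Büthe's range with the Platt–Trudgian height: for
`59 < x ≤ 2.169·10²⁵` the (strict) bounds hold — cf. `Buthe2016_thm2.plattTrudgian_range`.
[cite: Johnston2022PartialRH, Prop. 3.1 and Cor. 3.3] -/
theorem plattTrudgian_range (h : Johnston2022_thm32) (hRH : RiemannHypothesisUpTo 3000175332800)
    {x : ℝ} (h59 : 59 < x) (hx : x ≤ 2.169e25) :
    |ψ x - x| < Real.sqrt x / (8 * π) * Real.log x ^ 2 :=
  (range h hRH h59.le (hx.trans (by norm_num))).1

end Johnston2022_thm32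

namespace Johnston2022_thm41

/-- The row `a = 1`, `K = 1.19` of Theorem 4.1: RH up to `T` and `1.19√(x/log³ x) ≤ T` give
`|ψ(x) − x| < √x log² x` (`x ≥ 3`) etc. [cite: Johnston2022PartialRH, Thm. 4.1 and Table 2 (row a = 1)] -/
theorem row_one (h : Johnston2022_thm41) {T : ℝ} (hT : 0 < T) (hRH : RiemannHypothesisUpTo T) {x : ℝ}
    (hx : 1.19 * Real.sqrt (x / Real.log x ^ 3) ≤ T) :
    (3 ≤ x → |ψ x - x| < Real.sqrt x * Real.log x ^ 2) ∧
      (3 ≤ x → |θ x - x| < Real.sqrt x * Real.log x ^ 2) ∧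
      (2 ≤ x → |(Nat.primeCounting ⌊x⌋₊ : ℝ) - logIntegral x| < Real.sqrt x * Real.log x) := by
  have hmem : ((1 : ℝ), (1.19 : ℝ), (2.165e30 : ℝ)) ∈ Johnston2022.table2 := by
    simp [Johnston2022.table2]
  have H := h 1 1.19 2.165e30 hmem T hT hRH x hx
  simp only [one_mul] at H
  exact H

end Johnston2022_thm41

/-- With the two Ramanujan-inequality facts of the tree, `π(x)² < (ex/log x)π(x/e)` is known
unconditionally on `[38 358 837 683, e¹⁰³] ∪ [e³³⁶¹, ∞)`. [cite: Johnston2022PartialRH, Thm. 5.1]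
[cite: JohnstonYang2023, Thm. 1.5] -/
theorem Johnston2022_thm51.ramanujan_known_ranges (h : Johnston2022_thm51)
    (hJY : JohnstonYang2023_ramanujan_thm15) {x : ℝ} (hx : 38358837683 ≤ x)
    (hrange : x ≤ Real.exp 103 ∨ Real.exp 3361 ≤ x) :
    (Nat.primeCounting ⌊x⌋₊ : ℝ) ^ 2 <
      Real.exp 1 * x / Real.log x * (Nat.primeCounting ⌊x / Real.exp 1⌋₊ : ℝ) := by
  rcases hrange with h1 | h2
  · exact h x hx h1
  · exact hJY x h2

end Literature.NumberTheory.LFunctions
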